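import Mathlib
import HarnessLib
import Summits.AtomisticToContinuum.FouriersLaw.Theses.JunctionLocality
import Summits.AtomisticToContinuum.FouriersLaw.Theorems.JunctionLocalitySuperadditiveResistanceKuboGreen

/-!
# Kubo–Onsager for the γ-thermostatted pinned chain, IV: the Green identities without cutoff

Helper file (`--supports` stmt-AtomisticToContinuum-11748) for stub `stub_kuboOnsager` of the line
`floating-probe-bypass-laplacian` (crux `JunctionLocality.SuperadditiveResistance`). Setting as in parts II–III:
pinned chain `𝐏 = pinnedChain ω₂ lam β γ` (`ω₂ > 0`, `lam, β ≥ 0`), `T > 0`, weights `B ≥ 0`, friction `c > 0`,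
pairs `(f, k_f)` with `σ X_H f + c S_B f = −k_f` pointwise, `f ∈ C² ∩ L²(μ_T)`, `k_f ∈ L²(μ_T)`.

* `polar` — two `σ`-pairs: `∫ (h k_f + f k_h) ρ = 2 c T Σ_i B_i ∫ ∂_{p_i} f ∂_{p_i} h ρ`. The symmetric part of
  the Kubo pairing is the Ornstein–Uhlenbeck Dirichlet (Gram) form of the fields; `f = h` is the finite-volume
  fluctuation–dissipation identity `⟨g, k⟩ = c T Σ_i B_i ‖∂_{p_i} g‖²`.
* `cross` — a `σ`-pair against a `(−σ)`-pair (forward against backward): `∫ h k_f ρ = ∫ f k_h ρ`.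
Proof: parts II–III at cutoff level `n`, then `n → ∞` by dominated convergence (`tendsto_integral_chi_mul`,
`tendsto_integral_partialP_chi_mul`), the integrability of `∂_{p_i} f` at bathed sites being part II's
`memLp_partialP`. References: folklore; Eckmann–Pillet–Rey-Bellet 1999 §3.
-/

noncomputable section

open MeasureTheory Filter Topology ProbabilityTheory
open scoped ContDiff NNReal ENNReal
open Literature.MathematicalPhysics.KineticTheory.HeatConduction
open Summit.AtomisticToContinuum.FouriersLaw.Theorems.SuperadditiveResistance.DeviceLiouville

namespace Summit.AtomisticToContinuum.FouriersLaw.Theorems.SuperadditiveResistance.Kubo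

section Limit

variable {ω₂ lam β γ : ℝ} {L : ℕ}

set_option hygiene false in
/-- Local shorthand for the pinned chain of this section. -/
local notation "𝐏" => pinnedChain ω₂ lam β γ

/-- A weighted sum of sequences converges termwise; terms with weight `0` need not converge. [folklore] -/
theorem tendsto_sum_mul {ι : Type*} [Fintype ι] [DecidableEq ι] (B : ι → ℝ) (u : ℕ → ι → ℝ) (v : ι → ℝ)
    (h : ∀ i, B i ≠ 0 → Tendsto (fun n => u n i) atTop (𝓝 (v i))) :
    Tendsto (fun n => ∑ i, B i * u n i) atTop (𝓝 (∑ i, B i * v i)) := by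
  refine tendsto_finsetSum _ fun i _ => ?_
  by_cases hB : B i = 0
  · simp only [hB, zero_mul]
    exact tendsto_const_nhds
  · exact (h i hB).const_mul (B i)

/-- **Polarised Green identity.** For two `σ`-pairs `(f, k_f)`, `(h, k_h)` with `f, h ∈ C² ∩ L²(μ_T)`,
`k_f, k_h ∈ L²(μ_T)`, `B ≥ 0`, `c > 0`:  `∫ (h k_f + f k_h) ρ = 2 c T Σ_i B_i ∫ ∂_{p_i}f ∂_{p_i}h ρ`. [folklore] -/
theorem polar (hω : 0 < ω₂) (hl : 0 ≤ lam) (hβ : 0 ≤ β) (L : ℕ) {T : ℝ} (hT : 0 < T)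
    (B : Fin L → ℝ) (hB : ∀ i, 0 ≤ B i) (σ : ℝ) {c : ℝ} (hc : 0 < c) {f kf h kh : PhaseSpace L → ℝ}
    (hf : ContDiff ℝ 2 f) (hh : ContDiff ℝ 2 h)
    (hf2 : MemLp f 2 ((𝐏).gibbsMeasure L T)) (hh2 : MemLp h 2 ((𝐏).gibbsMeasure L T))
    (hkf2 : MemLp kf 2 ((𝐏).gibbsMeasure L T)) (hkh2 : MemLp kh 2 ((𝐏).gibbsMeasure L T))
    (hpf : ∀ x, σ * liouvilleOp 𝐏 L f x + c * bathOp L B T f x = -kf x)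
    (hph : ∀ x, σ * liouvilleOp 𝐏 L h x + c * bathOp L B T h x = -kh x) :
    ∫ x, (h x * kf x + f x * kh x) * (𝐏).gibbsDensity L T x =
      2 * c * T * ∑ i, B i * ∫ x, partialP i f x * partialP i h x * (𝐏).gibbsDensity L T x := by
  have hf1 : ContDiff ℝ 1 f := hf.of_le (by norm_cast)
  have hh1 : ContDiff ℝ 1 h := hh.of_le (by norm_cast)
  have hfc : Continuous f := hf.continuous
  have hhc : Continuous h := hh.continuous
  have hdfc : ∀ j, Continuous (partialP j f) := fun j => continuous_partialP hf1 one_ne_zero j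
  have hdhc : ∀ j, Continuous (partialP j h) := fun j => continuous_partialP hh1 one_ne_zero j
  have hkfc : Continuous kf := continuous_source B T σ c hf hpf
  have hkhc : Continuous kh := continuous_source B T σ c hh hph
  -- square integrability of the bathed momentum derivatives (part II)
  have hdf2 : ∀ i, 0 < B i → MemLp (partialP i f) 2 ((𝐏).gibbsMeasure L T) := fun i hi =>
    memLp_partialP hω hl hβ γ L hT B hB σ hc hf hf2 hkf2 hpf hi
  have hdh2 : ∀ i, 0 < B i → MemLp (partialP i h) 2 ((𝐏).gibbsMeasure L T) := fun i hi =>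
    memLp_partialP hω hl hβ γ L hT B hB σ hc hh hh2 hkh2 hph hi
  -- integrable limits
  have hI_lhs : Integrable fun x => (h x * kf x + f x * kh x) * (𝐏).gibbsDensity L T x := by
    have := (integrable_mul_mul_gibbsDensity hω hl hβ γ L hT hh2 hkf2).add
      (integrable_mul_mul_gibbsDensity hω hl hβ γ L hT hf2 hkh2)
    refine this.congr (ae_of_all _ fun x => ?_)
    simp only [Pi.add_apply]; ring
  have hI_dd : ∀ i, 0 < B i → Integrable fun x => partialP i f x * partialP i h x * (𝐏).gibbsDensity L T x :=
    fun i hi => integrable_mul_mul_gibbsDensity hω hl hβ γ L hT (hdf2 i hi) (hdh2 i hi)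
  have hI_err : ∀ i, 0 < B i → Integrable fun x => (h x * partialP i f x + f x * partialP i h x) *
      (𝐏).gibbsDensity L T x := by
    intro i hi
    have := (integrable_mul_mul_gibbsDensity hω hl hβ γ L hT hh2 (hdf2 i hi)).add
      (integrable_mul_mul_gibbsDensity hω hl hβ γ L hT hf2 (hdh2 i hi))
    refine this.congr (ae_of_all _ fun x => ?_)
    simp only [Pi.add_apply]; ring
  -- the level-n identity, in the shape of the limit lemmas
  have hlevel : ∀ n : ℕ, ∫ x, chi 𝐏 L n x * (h x * kf x + f x * kh x) * (𝐏).gibbsDensity L T x =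
      c * T * ∑ i, B i * (2 * (∫ x, chi 𝐏 L n x * (partialP i f x * partialP i h x) * (𝐏).gibbsDensity L T x) +
        ∫ x, partialP i (chi 𝐏 L n) x * (h x * partialP i f x + f x * partialP i h x) *
          (𝐏).gibbsDensity L T x) := by
    intro n
    rw [polar_level hω hl hβ L hT B σ c hf hh hpf hph n]
    congr 1
    refine Finset.sum_congr rfl fun i _ => ?_
    congr 2
    · congr 1
      exact integral_congr_ae (ae_of_all _ fun x => by ring)
    · exact integral_congr_ae (ae_of_all _ fun x => by ring)
  -- limits of both sides
  have hlim_lhs : Tendsto (fun n : ℕ => ∫ x, chi 𝐏 L n x * (h x * kf x + f x * kh x) * (𝐏).gibbsDensity L T x)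
      atTop (𝓝 (∫ x, (h x * kf x + f x * kh x) * (𝐏).gibbsDensity L T x)) :=
    tendsto_integral_chi_mul hω.le hl hβ γ L T (by fun_prop) hI_lhs
  have hlim_rhs : Tendsto (fun n : ℕ => c * T * ∑ i, B i *
      (2 * (∫ x, chi 𝐏 L n x * (partialP i f x * partialP i h x) * (𝐏).gibbsDensity L T x) +
        ∫ x, partialP i (chi 𝐏 L n) x * (h x * partialP i f x + f x * partialP i h x) *
          (𝐏).gibbsDensity L T x)) atTop
      (𝓝 (c * T * ∑ i, B i * (2 * (∫ x, partialP i f x * partialP i h x * (𝐏).gibbsDensity L T x) + 0))) := by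
    refine (tendsto_sum_mul B _ _ fun i hBi => ?_).const_mul (c * T)
    have hi : 0 < B i := lt_of_le_of_ne (hB i) (Ne.symm hBi)
    refine Tendsto.add ?_ ?_
    · exact (tendsto_integral_chi_mul hω.le hl hβ γ L T (by fun_prop) (hI_dd i hi)).const_mul 2
    · exact tendsto_integral_partialP_chi_mul hω hl hβ γ L T i (by fun_prop) (hI_err i hi)
  have heq := tendsto_nhds_unique hlim_lhs (hlim_rhs.congr fun n => (hlevel n).symm)
  rw [heq]
  simp only [add_zero, Finset.mul_sum]
  exact Finset.sum_congr rfl fun i _ => by ring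

/-- **Fluctuation–dissipation identity** (the case `f = h` of `polar`): for a `σ`-pair `(g, k)` with
`g ∈ C² ∩ L²(μ_T)`, `k ∈ L²(μ_T)`:  `∫ g k ρ = c T Σ_i B_i ∫ (∂_{p_i} g)² ρ`. In particular `⟨g, k⟩_{μ_T} ≥ 0`.
[folklore] -/
theorem fluctuation_dissipation (hω : 0 < ω₂) (hl : 0 ≤ lam) (hβ : 0 ≤ β) (L : ℕ) {T : ℝ} (hT : 0 < T)
    (B : Fin L → ℝ) (hB : ∀ i, 0 ≤ B i) (σ : ℝ) {c : ℝ} (hc : 0 < c) {g k : PhaseSpace L → ℝ}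
    (hg : ContDiff ℝ 2 g) (hg2 : MemLp g 2 ((𝐏).gibbsMeasure L T)) (hk2 : MemLp k 2 ((𝐏).gibbsMeasure L T))
    (hpde : ∀ x, σ * liouvilleOp 𝐏 L g x + c * bathOp L B T g x = -k x) :
    ∫ x, g x * k x * (𝐏).gibbsDensity L T x =
      c * T * ∑ i, B i * ∫ x, partialP i g x ^ 2 * (𝐏).gibbsDensity L T x := by
  have h := polar hω hl hβ L hT B hB σ hc hg hg hg2 hg2 hk2 hk2 hpde hpde
  have e1 : (fun x => (g x * k x + g x * k x) * (𝐏).gibbsDensity L T x) =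
      fun x => 2 * (g x * k x * (𝐏).gibbsDensity L T x) := by
    funext x; ring
  have e2 : ∀ i, (fun x => partialP i g x * partialP i g x * (𝐏).gibbsDensity L T x) =
      fun x => partialP i g x ^ 2 * (𝐏).gibbsDensity L T x := by
    intro i; funext x; ring
  rw [e1, integral_const_mul] at h
  simp only [e2] at h
  linarith

/-- **Cross Green identity.** For a `σ`-pair `(f, k_f)` and a `(−σ)`-pair `(h, k_h)` with
`f, h ∈ C² ∩ L²(μ_T)`, `k_f, k_h ∈ L²(μ_T)`, `B ≥ 0`, `c > 0`:  `∫ h k_f ρ = ∫ f k_h ρ`. [folklore] -/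
theorem cross (hω : 0 < ω₂) (hl : 0 ≤ lam) (hβ : 0 ≤ β) (L : ℕ) {T : ℝ} (hT : 0 < T)
    (B : Fin L → ℝ) (hB : ∀ i, 0 ≤ B i) (σ : ℝ) {c : ℝ} (hc : 0 < c) {f kf h kh : PhaseSpace L → ℝ}
    (hf : ContDiff ℝ 2 f) (hh : ContDiff ℝ 2 h)
    (hf2 : MemLp f 2 ((𝐏).gibbsMeasure L T)) (hh2 : MemLp h 2 ((𝐏).gibbsMeasure L T))
    (hkf2 : MemLp kf 2 ((𝐏).gibbsMeasure L T)) (hkh2 : MemLp kh 2 ((𝐏).gibbsMeasure L T))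
    (hpf : ∀ x, σ * liouvilleOp 𝐏 L f x + c * bathOp L B T f x = -kf x)
    (hph : ∀ x, -σ * liouvilleOp 𝐏 L h x + c * bathOp L B T h x = -kh x) :
    ∫ x, h x * kf x * (𝐏).gibbsDensity L T x = ∫ x, f x * kh x * (𝐏).gibbsDensity L T x := by
  have hf1 : ContDiff ℝ 1 f := hf.of_le (by norm_cast)
  have hh1 : ContDiff ℝ 1 h := hh.of_le (by norm_cast)
  have hfc : Continuous f := hf.continuous
  have hhc : Continuous h := hh.continuous
  have hdfc : ∀ j, Continuous (partialP j f) := fun j => continuous_partialP hf1 one_ne_zero j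
  have hdhc : ∀ j, Continuous (partialP j h) := fun j => continuous_partialP hh1 one_ne_zero j
  have hkfc : Continuous kf := continuous_source B T σ c hf hpf
  have hkhc : Continuous kh := continuous_source B T (-σ) c hh hph
  have hdf2 : ∀ i, 0 < B i → MemLp (partialP i f) 2 ((𝐏).gibbsMeasure L T) := fun i hi =>
    memLp_partialP hω hl hβ γ L hT B hB σ hc hf hf2 hkf2 hpf hi
  have hdh2 : ∀ i, 0 < B i → MemLp (partialP i h) 2 ((𝐏).gibbsMeasure L T) := fun i hi =>
    memLp_partialP hω hl hβ γ L hT B hB (-σ) hc hh hh2 hkh2 hph hi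
  have hI_a : Integrable fun x => h x * kf x * (𝐏).gibbsDensity L T x :=
    integrable_mul_mul_gibbsDensity hω hl hβ γ L hT hh2 hkf2
  have hI_b : Integrable fun x => f x * kh x * (𝐏).gibbsDensity L T x :=
    integrable_mul_mul_gibbsDensity hω hl hβ γ L hT hf2 hkh2
  have hI_err : ∀ i, 0 < B i → Integrable fun x => (h x * partialP i f x - f x * partialP i h x) *
      (𝐏).gibbsDensity L T x := by
    intro i hi
    have := (integrable_mul_mul_gibbsDensity hω hl hβ γ L hT hh2 (hdf2 i hi)).sub
      (integrable_mul_mul_gibbsDensity hω hl hβ γ L hT hf2 (hdh2 i hi))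
    refine this.congr (ae_of_all _ fun x => ?_)
    simp only [Pi.sub_apply]; ring
  have hlevel : ∀ n : ℕ, (∫ x, chi 𝐏 L n x * (h x * kf x) * (𝐏).gibbsDensity L T x) -
      (∫ x, chi 𝐏 L n x * (f x * kh x) * (𝐏).gibbsDensity L T x) =
      c * T * ∑ i, B i * ∫ x, partialP i (chi 𝐏 L n) x * (h x * partialP i f x - f x * partialP i h x) *
        (𝐏).gibbsDensity L T x := by
    intro n
    have e := cross_level hω hl hβ L hT B σ c hf hh hpf hph n
    have e1 : (fun x => chi 𝐏 L n x * (h x * kf x) * (𝐏).gibbsDensity L T x) =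
        fun x => chi 𝐏 L n x * h x * kf x * (𝐏).gibbsDensity L T x := by funext x; ring
    have e2 : (fun x => chi 𝐏 L n x * (f x * kh x) * (𝐏).gibbsDensity L T x) =
        fun x => chi 𝐏 L n x * f x * kh x * (𝐏).gibbsDensity L T x := by funext x; ring
    rw [e1, e2, e]
    congr 1
    refine Finset.sum_congr rfl fun i _ => ?_
    congr 1
    exact integral_congr_ae (ae_of_all _ fun x => by ring)
  have hlim_a : Tendsto (fun n : ℕ => ∫ x, chi 𝐏 L n x * (h x * kf x) * (𝐏).gibbsDensity L T x) atTop
      (𝓝 (∫ x, (h x * kf x) * (𝐏).gibbsDensity L T x)) :=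
    tendsto_integral_chi_mul hω.le hl hβ γ L T (by fun_prop) (hI_a.congr (ae_of_all _ fun x => by ring))
  have hlim_b : Tendsto (fun n : ℕ => ∫ x, chi 𝐏 L n x * (f x * kh x) * (𝐏).gibbsDensity L T x) atTop
      (𝓝 (∫ x, (f x * kh x) * (𝐏).gibbsDensity L T x)) :=
    tendsto_integral_chi_mul hω.le hl hβ γ L T (by fun_prop) (hI_b.congr (ae_of_all _ fun x => by ring))
  have hlim_rhs : Tendsto (fun n : ℕ => c * T * ∑ i, B i * ∫ x, partialP i (chi 𝐏 L n) x *
      (h x * partialP i f x - f x * partialP i h x) * (𝐏).gibbsDensity L T x) atTop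
      (𝓝 (c * T * ∑ i, B i * (0 : ℝ))) := by
    refine (tendsto_sum_mul B _ _ fun i hBi => ?_).const_mul (c * T)
    have hi : 0 < B i := lt_of_le_of_ne (hB i) (Ne.symm hBi)
    exact tendsto_integral_partialP_chi_mul hω hl hβ γ L T i (by fun_prop) (hI_err i hi)
  have heq := tendsto_nhds_unique (hlim_a.sub hlim_b) (hlim_rhs.congr fun n => (hlevel n).symm)
  simp only [mul_zero, Finset.sum_const_zero] at heq
  have ea : ∫ x, (h x * kf x) * (𝐏).gibbsDensity L T x = ∫ x, h x * kf x * (𝐏).gibbsDensity L T x :=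
    integral_congr_ae (ae_of_all _ fun x => by ring)
  have eb : ∫ x, (f x * kh x) * (𝐏).gibbsDensity L T x = ∫ x, f x * kh x * (𝐏).gibbsDensity L T x :=
    integral_congr_ae (ae_of_all _ fun x => by ring)
  linarith

end Limit

/-- Registered helper sub-goal `helper_kuboCross` of stub `stub_kuboOnsager` (= `cross` in stub form; line
`floating-probe-bypass-laplacian`, crux stmt-AtomisticToContinuum-11748). [folklore] -/
theorem helper_kuboCross : ∀ {ω₂ lam β γ : ℝ}, 0 < ω₂ → 0 ≤ lam → 0 ≤ β → ∀ (L : ℕ) {T : ℝ}, 0 < T → ∀ (B : Fin L → ℝ), (∀ i, 0 ≤ B i) → ∀ (σ : ℝ) {c : ℝ}, 0 < c → ∀ {f kf h kh : PhaseSpace L → ℝ}, ContDiff ℝ 2 f → ContDiff ℝ 2 h → MemLp f 2 ((pinnedChain ω₂ lam β γ).gibbsMeasure L T) → MemLp h 2 ((pinnedChain ω₂ lam β γ).gibbsMeasure L T) → MemLp kf 2 ((pinnedChain ω₂ lam β γ).gibbsMeasure L T) → MemLp kh 2 ((pinnedChain ω₂ lam β γ).gibbsMeasure L T) → (∀ x,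 σ * liouvilleOp (pinnedChain ω₂ lam β γ) L f x + c * bathOp L B T f x = -kf x) → (∀ x, -σ * liouvilleOp (pinnedChain ω₂ lam β γ) L h x + c * bathOp L B T h x = -kh x) → ∫ x, h x * kf x * (pinnedChain ω₂ lam β γ).gibbsDensity L T x = ∫ x, f x * kh x * (pinnedChain ω₂ lam β γ).gibbsDensity L T x :=
  @cross

end Summit.AtomisticToContinuum.FouriersLaw.Theorems.SuperadditiveResistance.Kubo

end
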